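import Summits.QuantumFields.BalabanUV.Beta.D1BFx.RoadEndRowPinned
import Summits.QuantumFields.BalabanUV.Beta.D1BFx.SbpScalarEndMean

/-!
# `BalabanUV.Beta.D1BFx.RoadEndRowPinnedSbp` — road «BF-x» for binder row D1, row «C3-SBP», MEAN LANE, file 2: the MEAN-grading END for the
# LITERAL OF RECORD `RowD1JointEnd.JsRowD1Pin` in the table currency (`RoadEndRowPinned.d1Drift_JsRowD1Pin_of_meanRoad_table_shell_of_slots`)
# WITH THE SHELL ROWS `h2s` ∕ `d2s` DELETED

HONEST DEPENDENCY (page 1, mandatory): continuum YM on T⁴ ⇐ BetaPertH ∧ nine spine estimates (0/9 proved); BetaPertH ⇐ (D1) ∧ (D4) ∧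
CAP+tail; G-an2-4 gates asym, D1 and NE2/3/4.  HONEST FRAMING (cell contract, verbatim): «discharging `BetaPertH` makes Bałaban's UV
stability UNCONDITIONAL — a real constructive-QFT result; it is NOT the continuum limit and NOT the Clay problem.»  THIS MODULE DISCHARGES
NOTHING of the wall: [folklore] composition BY NAME of leaf-03's `RoadEndRowPinned.exists_allScalesSeq_JsRowD1Pin_of_slots` (the `hall` supplier
on the (E)-family S-∕W-slot socket) with this lineage's `SbpScalarEndMean.d1Drift_of_meanRoad_table_sbp` (the mean END without the second-difference
rows, on the OWNER d1-p2's summation-by-parts A₁-form «C3-SBP»).  EVERY S-∕W-slot row, (B1_mean), (T_mean) and every leg row below is a HYPOTHESIS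
with free constants; the one-shot coefficient `c` is FREE.  No `def`, no `Prop` minted, nothing printed asserted, 0 sorry; 0∕4 binders of row D1
(hW, hR, D1Tel, D1Rep) instantiated; NOT D1, NOT `BetaPertH`, NOT continuum, NOT Clay.

ABSOLUTE RULE (cell charter, verbatim): «No internally-minted statement may enter as a cited fact. Every hypothesis is either kernel-proved in
this package or a verbatim quotation of a PUBLISHED theorem with page reference. The manuscript(s) under audit are NOT citable for their own
disputed steps — they are the thing under adjudication; programme-internal (2001/route/tribunal) claims are never citable.»

WHY (owner d1-p2 gen 13, «C3-SBP» RESULT + OFFER, journal 2026-08-21 l.35219): the scalar wall needs no mixed-second-difference row; the mean-lane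
ENDs of record (`RoadEndRowPinned` §3 → `RoadEndBFxTotalMeanShellS` → `RoadEndBFxWiredMeanS` → `RoadEndBFxD1SumMeanS`) still DISPLAY `h2s` ∕ `d2s`.
This file is the second mean-lane twin: the literal-of-record END of `RoadEndRowPinned` §3 with the two rows struck (file 1 = `SbpScalarEndMean`).

CONTENT (`d + 1 = 4`; odd `Lc ≥ 2`, centred root, the pinned constants of `RoadEndRowPinned` §2 VERBATIM).
* `d1Drift_JsRowD1Pin_of_meanRoad_table_sbp_of_slots` — `RoadEndRowPinned.d1Drift_JsRowD1Pin_of_meanRoad_table_shell_of_slots` minus `h2s` ∕ `d2s`: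
  (B1_mean), the MEAN target in the table currency over a scalar leg family `Gf` with convex base-point weights, the FOUR first-order rows
  `h0` ∕ `h1` ∕ `d0` ∕ `d1`, on the (E)-family S-∕W-slot socket ⟹ `D1Drift Lc (JsRowD1Pin hLc N) Nc μ ν`.
Unit `b2b-balaban-gan24-formalise-leaf-05` (gen 46), G-an2-4 swarm leaf prover on the D1 formalisation swarm's road «BF-x» (owner OFFER l.35219,
mean lane); `LEAVES-BFx.md` row «C3-SBP», sub-row «MEAN LANE».
-/

open Finset Filter Topology
open scoped BigOperators
open Literature.MathematicalPhysics.QuantumFieldTheory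
open Literature.MathematicalPhysics.QuantumFieldTheory.Balaban1983to89
open Literature.MathematicalPhysics.QuantumFieldTheory.Balaban1983to89.Beta
open ExpKernelCalculus (VertexFamily₂)
open AffineAveraging (toSite)
open AveragingContoursRooted (ctrOff)
open AveragingMixedJetTables (mixFFAt)
open OneStepResolventKernel (LocStencil)
open OneStepKernelFamily (TbalOf D1Drift)
open WilsonVertex2Sym (wsym22)
open WindowIdentification (fullSum)
open DyadicShell (Pt supNorm)
open SquareTable (stK)
open GhostTable (gFree)
open BubbleTransfer (unitVec)
open Summit.QuantumFields.BalabanUV.Beta.HessKerDressedUnits (unitS unitW)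
open Summit.QuantumFields.BalabanUV.Beta.SpineRooted (WrecAt)
open Summit.QuantumFields.BalabanUV.Beta.WardLocusRecursive (SrecAt)
open Summit.QuantumFields.BalabanUV.Beta.SecondOrderSocketIdentification (vh₂SAn1)
open Summit.QuantumFields.BalabanUV.Beta.RowD1JointEnd (JsRowD1Pin)
open Summit.QuantumFields.BalabanUV.Beta.GAN24.CombesThomas (sfStep smStep)
open Summit.QuantumFields.BalabanUV.Beta.D1BFx.RoadEndRowPinned (exists_allScalesSeq_JsRowD1Pin_of_slots)
open Summit.QuantumFields.BalabanUV.Beta.D1BFx.SbpScalarEndMean (d1Drift_of_meanRoad_table_sbp)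

namespace Summit.QuantumFields.BalabanUV.Beta.D1BFx.RoadEndRowPinnedSbp

noncomputable section

section Mean

variable {Lc : ℕ} [NeZero Lc] {κB : Type*} {Cs cS δS θS Cw cW δW θW : ℝ} (hLc : Odd Lc) (hL2 : 2 ≤ Lc) (N : ℕ)
  (hS : ∀ j, LocStencil (unitS (sfStep Lc j) (smStep 3 Lc j)
    (SrecAt 3 Lc (toSite (ctrOff (3 + 1) Lc)) ((Lc : ℝ) ^ 4) (-((Lc : ℝ) ^ 8 / 2)) (2 / (Lc : ℝ) ^ 4) j)) Cs δS)
  (hSall : ∀ k j, LocStencil (unitS (sfStep Lc (k + j)) (smStep 3 Lc (k + j))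
      (SrecAt 3 Lc (toSite (ctrOff (3 + 1) Lc)) ((Lc : ℝ) ^ 4) (-((Lc : ℝ) ^ 8 / 2)) (2 / (Lc : ℝ) ^ 4) (k + j)) -
    unitS (sfStep Lc k) (smStep 3 Lc k)
      (SrecAt 3 Lc (toSite (ctrOff (3 + 1) Lc)) ((Lc : ℝ) ^ 4) (-((Lc : ℝ) ^ 8 / 2)) (2 / (Lc : ℝ) ^ 4) k)) (cS * θS ^ k) δS)
  (hW : ∀ j, VertexFamily₂ (unitW (sfStep Lc j) (smStep 3 Lc j)
    (WrecAt 3 Lc (toSite (ctrOff (3 + 1) Lc)) ((Lc : ℝ) ^ 4) (-((Lc : ℝ) ^ 8 / 2)) (2 / (Lc : ℝ) ^ 4) ((Lc : ℝ) ^ 8) (-((Lc : ℝ) ^ 12 / 4))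
      ((8 * (N : ℝ) ^ 2)⁻¹ • wsym22 N) (vh₂SAn1 Lc) (mixFFAt (toSite (ctrOff (3 + 1) Lc)) Lc) j)) Lc Cw δW)
  (hWall : ∀ k j, VertexFamily₂ (unitW (sfStep Lc (k + j)) (smStep 3 Lc (k + j))
      (WrecAt 3 Lc (toSite (ctrOff (3 + 1) Lc)) ((Lc : ℝ) ^ 4) (-((Lc : ℝ) ^ 8 / 2)) (2 / (Lc : ℝ) ^ 4) ((Lc : ℝ) ^ 8) (-((Lc : ℝ) ^ 12 / 4))
        ((8 * (N : ℝ) ^ 2)⁻¹ • wsym22 N) (vh₂SAn1 Lc) (mixFFAt (toSite (ctrOff (3 + 1) Lc)) Lc) (k + j)) -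
    unitW (sfStep Lc k) (smStep 3 Lc k)
      (WrecAt 3 Lc (toSite (ctrOff (3 + 1) Lc)) ((Lc : ℝ) ^ 4) (-((Lc : ℝ) ^ 8 / 2)) (2 / (Lc : ℝ) ^ 4) ((Lc : ℝ) ^ 8) (-((Lc : ℝ) ^ 12 / 4))
        ((8 * (N : ℝ) ^ 2)⁻¹ • wsym22 N) (vh₂SAn1 Lc) (mixFFAt (toSite (ctrOff (3 + 1) Lc)) Lc) k)) Lc (cW * θW ^ k) δW)
  (hδS : 0 < δS) (hδW : 0 < δW) (hθS0 : 0 ≤ θS) (hθS1 : θS < 1) (hθW0 : 0 ≤ θW) (hθW1 : θW < 1)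
include hL2 hS hSall hW hWall hδS hδW hθS0 hθS1 hθW0 hθW1

/-- [folklore] **THE MEAN ROAD END FOR THE LITERAL OF RECORD, TABLE CURRENCY, NO SECOND-DIFFERENCE ROW ⟸ THE (E)-FAMILY S-∕W-SLOT ROWS**:
`RoadEndRowPinned.d1Drift_JsRowD1Pin_of_meanRoad_table_shell_of_slots` with the shell rows `h2s` ∕ `d2s` DELETED — (B1_mean) a Cesàro-null telescoping
defect of the step coefficients of `JsRowD1Pin hLc N` against a one-shot coefficient `c (Lc^m)`, the MEAN target
`(c (Lc^m) − Σ_b wt·fullSum (stK μ ν Nc (Gf (Lc^m) b)))∕m → 0` over a scalar leg family `Gf` with convex base-point weights, and the FOUR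
first-order rows `h0` ∕ `h1` ∕ `d0` ∕ `d1` ⟹ `D1Drift Lc (JsRowD1Pin hLc N) Nc μ ν` — `SbpScalarEndMean.d1Drift_of_meanRoad_table_sbp` at §2's `hall`
(`RoadEndRowPinned.exists_allScalesSeq_JsRowD1Pin_of_slots`), CONDITIONAL on the four slot rows. -/
theorem d1Drift_JsRowD1Pin_of_meanRoad_table_sbp_of_slots {μ ν : Fin 4} (hμν : μ ≠ ν) {Nc : ℝ} (hNc : Nc ≠ 0) (c : ℕ → ℝ)
    {Bset : ℕ → Finset κB} {wt : ℕ → κB → ℝ} {Gf : ℕ → κB → Pt → ℝ} {D A : ℕ → ℝ}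
    (hD : ∀ j, 0 ≤ D j) (hA : ∀ j, 0 ≤ A j) {δ : ℝ} (hδ : 0 < δ)
    (hwt0 : ∀ n : ℕ, 2 ≤ n → ∀ b ∈ Bset n, 0 ≤ wt n b) (hwt1 : ∀ n : ℕ, 2 ≤ n → ∑ b ∈ Bset n, wt n b = 1)
    (h0 : ∀ n : ℕ, 2 ≤ n → ∀ b ∈ Bset n, ∀ v, |Gf n b v - gFree v| ≤ D 0 / (n : ℝ) ^ 2)
    (h1 : ∀ n : ℕ, 2 ≤ n → ∀ b ∈ Bset n, ∀ v (ρ : Fin 4),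
      |(Gf n b (v + unitVec ρ) - gFree (v + unitVec ρ)) - (Gf n b v - gFree v)| ≤ D 1 / (n : ℝ) ^ 3)
    (d0 : ∀ n : ℕ, 2 ≤ n → ∀ b ∈ Bset n, ∀ v : Pt, v ≠ 0 → |Gf n b v| ≤ A 0 * Real.exp (-(δ / n) * supNorm v) / (supNorm v : ℝ) ^ 2)
    (d1 : ∀ n : ℕ, 2 ≤ n → ∀ b ∈ Bset n, ∀ v : Pt, v ≠ 0 → ∀ ρ : Fin 4,
      |Gf n b (v + unitVec ρ) - Gf n b v| ≤ A 1 * Real.exp (-(δ / n) * supNorm v) / (supNorm v : ℝ) ^ 3)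
    (hB1 : Tendsto (fun m : ℕ => ((∑ j ∈ range m, B12Beta.secondMoment (TbalOf Lc (JsRowD1Pin hLc N) j) μ ν) - c (Lc ^ m)) / (m : ℝ))
      atTop (𝓝 0))
    (hT : Tendsto (fun m : ℕ => (c (Lc ^ m) - ∑ b ∈ Bset (Lc ^ m), wt (Lc ^ m) b * fullSum (stK μ ν Nc (Gf (Lc ^ m) b))) / (m : ℝ))
      atTop (𝓝 0)) :
    D1Drift Lc (JsRowD1Pin hLc N) Nc μ ν := by
  obtain ⟨κ, θ, hθ0, hθ1, hall⟩ := exists_allScalesSeq_JsRowD1Pin_of_slots hLc hL2 N hS hSall hW hWall hδS hδW hθS0 hθS1 hθW0 hθW1 μ ν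
  exact d1Drift_of_meanRoad_table_sbp _ hμν hNc hL2 hall hθ0 hθ1 c hD hA hδ hwt0 hwt1 h0 h1 d0 d1 hB1 hT

end Mean

end

end Summit.QuantumFields.BalabanUV.Beta.D1BFx.RoadEndRowPinnedSbp
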